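import Summits.CriticalPhenomena.SAWScalingLimit.Theses.SAWTwistedSelfEnergy
import Literature.Probability.RandomPlanarGeometry.TwistedLaceExpansionIdentity

/-!
# Birth skeleton (`Lines/birth.lean`) for crux `TwistedKernelSummable` (stmt-CriticalPhenomena-17872)

Route `SAWTwistedSelfEnergy` of `CriticalPhenomena/SAWScalingLimit`; the crux (rank 2, concluded BY NAME by
`TwistedKernelSummable_of`) says: for the spin-`5/8` twisted two-point matrices `G_n(z) ∈ ℂ^{4×4}` of the
`ℤ²` self-avoiding walk (fictitious incoming step `ι`, last step `κ`, weight `e^{-i(5/8)W}`), every kernel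
`K` with `supp K_n ⊆ {-n,…,n}²` solving the MIXED resolvent recursion
`G_n = G_{n-1} ⋆ D + Σ_{m=1}^{n} K_m ⋆ G_{n-m}` (`n ≥ 1`; free step APPENDED, kernel on the LEFT;
`D(y)(a,b) = T(a,b)·𝟙[y = e_b]`) is absolutely summable at criticality:
`Σ_{(n,z)} x_c^n Σ_{ι,κ} |K_n(z)(ι,κ)| < ∞`.

## The line — conjugated self-energy: `K̂ = Ĝ Π̂ Ĝ⁻¹ = Π̂ − x Ĝ ⋆ [Π̂, D]`

Since the item was filed, the tree acquired the twisted lace expansion in FIRST-STEP form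
(`LaceExpansion.twistedTwoPoint_succ`, `TwistedLaceExpansionIdentity.lean`, p133538):
`G_{n+1} = D ⋆ G_n + Σ_{m=1}^{n+1} Π^σ_m ⋆ G_{n+1-m}` with the twisted lace coefficient
`Π^σ = twistedLaceCoefficient σ` (`TwistedLaceCoefficient.lean`, p132894), i.e. `(E − xD − Π̂)Ĝ = E` as formal
power series in the length with values in `Mat₄(ℂ[ℤ²])`.  A one-sided inverse in `Mat₄` of the commutative ring
`ℂ[ℤ²][[x]]` is two-sided, so also `Ĝ(E − xD − Π̂) = E`, and comparing with the item's mixed recursion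
`Ĝ = E + xĜD + K̂Ĝ` gives `K̂Ĝ = ĜΠ̂`, i.e. THE (unique from length 1 on) mixed kernel is the lace self-energy
CONJUGATED by the full two-point matrix:
`K̂ = ĜΠ̂Ĝ⁻¹ = Π̂ + Ĝ(Π̂M − MΠ̂) = Π̂ − x Ĝ ⋆ (Π̂ ⋆ D − D ⋆ Π̂)`, `M = E − xD − Π̂`;
coefficientwise `K_n = Π^σ_n − Σ_{a+b+1=n} G_a ⋆ (Π^σ_b ⋆ D − D ⋆ Π^σ_b)` (`K_n = Π^σ_n` for `n ≤ 4` only; the grounder's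
exact enumeration to `n = 12` confirms the relation entrywise, evidence `SAW_kernel_grounding.md` on the item).
So the crux as typed splits EXACTLY into the card's intended statement and a convention surcharge:

* `stub_mixedKernelIdentification : MixedKernelIdentification` (pure algebra, provable now, L) — every mixed
  kernel `K` (the item's `IsTwistedKernel`, restated letter for letter as `IsMixedKernel`) satisfies, for `n ≥ 1`,
  `K_n(z) = Π^{5/8}_n(z) − Corr_n(z)`, `Corr_n(z) = Σ_{b<n} Σ_{y} G^{5/8}_{n-1-b}(z − y) · [Π^{5/8}_b, D](y)`
  (`mixedCorrection`, `laceStepCommutator`).  (`K_0(0)` is unconstrained by the item and excluded.)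
* `stub_laceKernelSummable : LaceKernelSummable` (research-open; the card's K1 in the lace convention) —
  `Σ_{(n,z)} x_c^n Σ_{ι,κ} |Π^{5/8}_n(z)(ι,κ)| < ∞`.
* `stub_conjugationSummable : ConjugationSummable` (research-open; HARDEST and the typed crux's real risk) —
  `Σ_{(n,z)} x_c^n Σ_{ι,κ} |Corr_n(z)(ι,κ)| < ∞`: the conjugation correction, which carries the full critical
  two-point matrix `Ĝ(x_c)` (not `ℓ¹`) against the zero-mass commutator `[Π̂, D]`, is `ℓ¹` at `x_c`.
* `TwistedKernelSummable_of` (kernel-checked, no `sorry`): `|K_n(z)(ι,κ)| ≤ |Π_n| + |Corr_n|` for `n ≥ 1`,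
  `K_0(z) = 0` for `z ≠ 0` (support clause), one extra summand at `(0,0)`; comparison
  (`Summable.of_nonneg_of_le`) with `stub₂ + stub₃ + 𝟙_{(0,0)}·|K_0(0)|`.  The crux's `let`-vocabulary unfolds
  to `IsMixedKernel` definitionally (`show`).

Given stubs 1–2 the crux is EQUIVALENT to stub 3 (`|Corr_n| ≤ |Π_n| + |K_n|`), so this skeleton is the faithful
cut of the typed statement: stub 2 is what the card (`twisted-self-energy-half-cr` K1) and the route header
mean ("lace identity → N-loop bounds"), stub 3 is what the mixed convention adds.  Neither stub is the crux or
the summit (BC3 probes below); stub 1 alone gives nothing analytic, stub 2 is about `Π^σ ≠ K` (from `n = 5`),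
stub 3 about `Corr ≠ K`.

## Disproof / negatives used
* `Cruxes/TwistedKernelSummable/`: no workfiles at registration (`ledger crux ls stmt-CriticalPhenomena-17872`,
  2026-08-17): no `Disproof.lean`, no `_false_without_` obstruction to honour, no dead lines.
* `ledger negatives --problem CriticalPhenomena` (11 entries, 2026-08-17): none concerns lace kernels,
  self-energies or two-point matrices; the SAW ones (stmt-0772 all-`δ` tightness, stmt-5420 free-discretisation
  hex observable, stmt-8261 infinite divisibility, stmt-8312 phase-retrieval stability) are not touched by any
  stub (whole-plane `x_c`-weighted length series only; no tightness, positivity or stability claim).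
* Item evidence honoured: the convention audit (`conventions_evidence.md`, literature-prover) and the grounder's
  relation `K̂ = Π̂^σ − xĜ[Π̂^σ, D]` (`SAW_kernel_grounding.md`) are exactly stub 1; the refuter's vacuity check
  (one solution from length 1 on; `K_1 = K_2 = K_3 = 0`, `tr K_4(0) = 4√2`) is consistent with it
  (`Π^σ_m = K_m`, `m ≤ 4`).
* BC3 certificate (planner, 2026-08-17): `lean check --json` of this file rc 0, errors [], sorries 3 = the three
  `stub_*`, zero elsewhere (audit: `TwistedKernelSummable_of` proof.conditional exactly on the three
  `Registered.stub_*`; `mixedT_eq_twistedStepMatrix`, `mixedG_eq_twistedTwoPoint` closed).  Probes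
  `bc/<Stub>_{crux,summit}_probe.lean` (= §§1–2 of this file + `example : <Stub> → TwistedKernelSummable` resp.
  `→ _root_.SAWScalingLimit` `by first | exact? | simpa [<Stub>] | (unfold <Stub>; simpa) | aesop`,
  `maxHeartbeats 400000`): 6/6 FAIL (rc 1, "unsolved goals", aesop "failed to prove the goal after exhaustive
  search"; 26/15/55/17/48/16 s); split probes (each tactic its own `example`, `bc/<Stub>_split.lean`): 30/30 FAIL —
  `exact?` "could not close the goal" (6/6), `simpa [·]` / `unfold ·; simpa` "Tactic `assumption` failed" on the
  unfolded implication (12/12), `aesop` / `unfold ·; aesop` exhaustive search failed (12/12).  No stub is cheaply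
  the crux or the summit.

Namespace `…Cruxes.TwistedKernelSummable.Birth`; statements over tree vocabulary only (`LaceExpansion.stepDir`,
`twistedStepMatrix`, `twistedTwoPoint`, `twistedLaceCoefficient`, `LatticeModels.box`, `turning`, `winding`,
`Site.toComplex`, `zdGraph`, `criticalFugacity`).
-/

noncomputable section

open scoped BigOperators
open Literature.Probability.LatticeModels
open Literature.Probability.RandomPlanarGeometry.LaceExpansion
open Literature.Probability.RandomPlanarGeometry.SAW (criticalFugacity)

namespace Summit.CriticalPhenomena.SAWScalingLimit.Cruxes.TwistedKernelSummable.Birth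

/-! ### 1. Vocabulary: the item's `let`-bound objects, named (letter for letter) -/

/-- The item's step matrix `T` (`= twistedStepMatrix (5/8)` entrywise, `Matrix.of_apply`): `T(a,b) = 0` on an
immediate reversal, else `e^{-i(5/8)θ(a→b)}`. Written exactly as the item's `let T` with `dir := stepDir`,
`σ := 5/8`. -/
def mixedT : Matrix (Fin 4) (Fin 4) ℂ := fun a b =>
  if stepDir b = -stepDir a then 0 else
    Complex.exp (-Complex.I * (5 / 8 : ℝ) *
      (turning (-Site.toComplex (stepDir a)) 0 (Site.toComplex (stepDir b)) : ℝ))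

/-- The item's twisted two-point matrix `G n z` (`= twistedTwoPoint (5/8) n z` by
`twistedTwoPoint_zero_apply` / `twistedTwoPoint_eq_sum_paths`): for `n ≥ 1` the sum over `n`-step
self-avoiding Mathlib walks `p : 0 → z` of `e^{-i(5/8)W}`, `W` the winding of `-e_ι :: p.support`, walks
reversing `e_ι` at the first step or not ending with step `e_κ` contributing `0`; `G 0 z = δ_{z,0} I`.
Written exactly as the item's `let G`. -/
def mixedG : ℕ → Site 2 → Matrix (Fin 4) (Fin 4) ℂ := fun n z ι κ =>
  if n = 0 then (if z = 0 ∧ ι = κ then 1 else 0) else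
    ∑ p ∈ ((zdGraph 2).finsetWalkLength n (0 : Site 2) z).filter (fun p => p.IsPath),
      (if p.getVert 1 = -stepDir ι ∨ z - p.getVert (n - 1) ≠ stepDir κ then 0 else
        Complex.exp (-Complex.I * (5 / 8 : ℝ) *
          (winding ((-Site.toComplex (stepDir ι)) :: (p.support.map Site.toComplex)) : ℝ)))

/-- **The item's hypothesis** `IsTwistedKernel K`, named: `K_n` is supported in the box of radius `n`, and
the MIXED resolvent recursion `G_n = G_{n-1} ⋆ D + Σ_{m=1}^{n} K_m ⋆ G_{n-m}` holds for all `n ≥ 1` and all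
`z` (free step appended on the right, kernel multiplied on the left). Written exactly as the item's
`let IsTwistedKernel`, so that the crux unfolds to `∀ K, IsMixedKernel K → Summable …` definitionally. -/
def IsMixedKernel (K : ℕ → Site 2 → Matrix (Fin 4) (Fin 4) ℂ) : Prop :=
  (∀ n z, z ∉ box 2 n → K n z = 0) ∧
  (∀ n, 1 ≤ n → ∀ z, mixedG n z =
    Matrix.of (fun ι κ => ∑ κ' : Fin 4, mixedG (n - 1) (z - stepDir κ) ι κ' * mixedT κ' κ) +
      ∑ m ∈ Finset.Icc 1 n, ∑ y ∈ box 2 m, K m y * mixedG (n - m) (z - y))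

/-- **The lace/step commutator** `[Π^{5/8}_b, D](y) = (Π_b ⋆ D)(y) − (D ⋆ Π_b)(y)`: the twisted lace
coefficient of length `b` with the free step APPENDED (`Σ_{κ'} Π_b(y − e_κ)(ι,κ') T(κ',κ)`) minus the same with
the free step PREPENDED (`Σ_λ T(ι,λ) Π_b(y − e_λ)(λ,κ)`); supported in the box of radius `b + 1`; zero total
mass (`[Π̂_b(0), T] = 0`, both being `D₄`-covariant), non-zero from `b = 4` on. -/
def laceStepCommutator (b : ℕ) (y : Site 2) : Matrix (Fin 4) (Fin 4) ℂ :=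
  Matrix.of fun ι κ =>
    (∑ κ' : Fin 4, twistedLaceCoefficient (5 / 8) b (y - stepDir κ) ι κ' * twistedStepMatrix (5 / 8) κ' κ) -
      (∑ lam : Fin 4, twistedStepMatrix (5 / 8) ι lam * twistedLaceCoefficient (5 / 8) b (y - stepDir lam) lam κ)

/-- **The conjugation correction** `Corr_n(z) = [x Ĝ ⋆ [Π̂, D]]_n(z) = Σ_{b<n} Σ_{y ∈ box(b+1)}
G^{5/8}_{n-1-b}(z − y) · [Π^{5/8}_b, D](y)` (matrix products, the two-point matrix on the LEFT):
the difference `Π^{5/8}_n − K_n` between the lace self-energy and the item's mixed kernel. -/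
def mixedCorrection (n : ℕ) (z : Site 2) : Matrix (Fin 4) (Fin 4) ℂ :=
  ∑ b ∈ Finset.range n, ∑ y ∈ box 2 (b + 1),
    twistedTwoPoint (5 / 8) (n - 1 - b) (z - y) * laceStepCommutator b y

/-! ### 2. The three stub statements -/

/-- STUB 1 statement — **identification of the mixed kernel** (pure algebra): every kernel satisfying the
item's hypothesis equals, from length `1` on, the conjugated lace self-energy
`K_n = Π^{5/8}_n − Corr_n`, i.e. `K̂ = Ĝ Π̂ Ĝ⁻¹ = Π̂ − x Ĝ ⋆ (Π̂ ⋆ D − D ⋆ Π̂)` coefficientwise.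
(`K_0(0)` is not constrained by the item and is excluded.) -/
def MixedKernelIdentification : Prop :=
  ∀ K : ℕ → Site 2 → Matrix (Fin 4) (Fin 4) ℂ, IsMixedKernel K →
    ∀ n, 1 ≤ n → ∀ z, K n z = twistedLaceCoefficient (5 / 8) n z - mixedCorrection n z

/-- STUB 2 statement — **the twisted lace self-energy is `ℓ¹` at criticality** (card K1 in the lace
convention): `Σ_{(n,z)} x_c^n Σ_{ι,κ} |Π^{5/8}_n(z)(ι,κ)| < ∞`. -/
def LaceKernelSummable : Prop :=
  Summable (fun p : ℕ × Site 2 =>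
    criticalFugacity ^ p.1 * ∑ ι : Fin 4, ∑ κ : Fin 4, ‖twistedLaceCoefficient (5 / 8) p.1 p.2 ι κ‖)

/-- STUB 3 statement — **the conjugation correction is `ℓ¹` at criticality**:
`Σ_{(n,z)} x_c^n Σ_{ι,κ} |Corr_n(z)(ι,κ)| < ∞`. -/
def ConjugationSummable : Prop :=
  Summable (fun p : ℕ × Site 2 =>
    criticalFugacity ^ p.1 * ∑ ι : Fin 4, ∑ κ : Fin 4, ‖mixedCorrection p.1 p.2 ι κ‖)

-- END OF STATEMENTS (the BC3 probe files copy the file up to this line)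

/-! ### 2b. Conventions verified (no `sorry`): the item's vocabulary IS the Literature's

These two lemmas are what a prover of stub 1 rewrites with first: after them `IsMixedKernel K` is a
statement about `twistedTwoPoint (5/8)`, `twistedStepMatrix (5/8)`, `stepDir` only, and the landed
first-step identity `twistedTwoPoint_succ` applies. -/

/-- The item's step matrix is the Literature's twisted step matrix at `σ = 5/8` (definitionally:
`Matrix.of` is the identity). -/
theorem mixedT_eq_twistedStepMatrix : mixedT = twistedStepMatrix (5 / 8) := rfl

/-- The item's two-point matrix is the Literature's twisted two-point matrix at `σ = 5/8`:
`G 0 = δ I` (`twistedTwoPoint_zero_apply`) and, for `n ≥ 1`, the bridge `twistedTwoPoint_eq_sum_paths`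
(sum over self-avoiding Mathlib walks, verbatim the item's expression). -/
theorem mixedG_eq_twistedTwoPoint : mixedG = twistedTwoPoint (5 / 8) := by
  funext n z ι κ
  rcases Nat.eq_zero_or_pos n with rfl | hn
  · rw [twistedTwoPoint_zero_apply]
    rfl
  · dsimp only [mixedG]
    rw [if_neg hn.ne', twistedTwoPoint_eq_sum_paths _ hn.ne']

/-! ### 3. The registered stubs (the only `sorry`s of the file) -/

/-- STUB 1 (provable now, size L): the mixed kernel is the conjugated lace self-energy. Why true: the landed
first-step identity `twistedTwoPoint_succ` reads `(E − xD − Π̂)Ĝ = E` in `Mat₄(ℂ[ℤ²][[x]])`; a one-sided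
inverse over the commutative ring `ℂ[ℤ²][[x]]` is two-sided (`det`), so `Ĝ(E − xD − Π̂) = E`; the item's
recursion is `Ĝ = E + xĜD + K̂Ĝ` (the item's `G`, `T`, `dir` are `twistedTwoPoint (5/8)`
(`twistedTwoPoint_eq_sum_paths`, `twistedTwoPoint_zero_apply`), `twistedStepMatrix (5/8)`, `stepDir`), hence
`K̂Ĝ = ĜΠ̂` and `K̂ = ĜΠ̂(E − xD − Π̂) = Π̂ − xĜ(Π̂D − DΠ̂)`; equivalently a strong induction on `n` using both
recursions and `Σ_y K_n(y) G_0(z−y) = K_n(z)` (`sum_mul_twistedTwoPoint_zero`). Lean route: embed the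
finitely supported matrix-valued sequences into `Matrix (Fin 4) (Fin 4) (PowerSeries (AddMonoidAlgebra ℂ (Site 2)))`
or induct directly on `Finset` sums. -/
theorem stub_mixedKernelIdentification : MixedKernelIdentification := by
  sorry

/-- STUB 2 (research-open, the card's K1 proper): `Σ x_c^n ‖Π^{5/8}_n‖₁ < ∞`. Why plausibly true: the phases
`e^{-i(5/8)W}` decorrelate the lace diagrams; exact enumeration in the typed entrywise `ℓ¹` norm (grounder,
`SAW_kernel_grounding.md`, `n = 4..12`): `x_c^n‖Π_n‖₁ = .345, .133, .144, .110, .073, .079, .056, .054, .048`,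
effective decay exponent `≈ 1.6 > 1` over `n = 6 → 12` (prediction `25/16` from the `|x|^{-11/4}` tail, card
§C2; the literature-prover's `n ≤ 11` table in the route's matrix norm agrees). Why it might fail: no small
parameter in `d = 2` (`Literature.Barriers.CriticalPhenomena.LaceExpansionMeanField`); `‖Π^{σ,(N)}_n‖ ≤ π^{(N)}_n`
(`norm_twistedLaceCoefficientN_le_piN`) is useless termwise at `x_c` — only cancellation ACROSS `N` and
across walks can give summability; `n ≤ 12` decides nothing. -/
theorem stub_laceKernelSummable : LaceKernelSummable := by
  sorry

/-- STUB 3 (research-open, HARDEST; isolates the surcharge of the item's mixed convention):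
`Σ x_c^n ‖Corr_n‖₁ < ∞` for `Corr = xĜ ⋆ [Π̂, D]`. Why it might hold: `[Π̂_b, D]` has zero total mass
(`D₄`-covariance) so `Ĝ ⋆ [Π̂,D]` only sees discrete gradients of the critical twisted two-point matrix, whose
`z`-sums are numerically flat in `n` (`x_c^n‖G_n‖₁ ≈ 6.25`, grounder, `n ≤ 12`) thanks to winding-phase
decoherence. Why it might fail (the typed crux's real risk): `Ĝ(x_c) ∉ ℓ¹` and `[Π̂, D]` has no first absolute
moment if the `Π`-tail is `|x|^{-11/4}` (`TwistedKernelTailIndex`), so the naive count gives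
`x_c^n‖Corr_n‖₁ ≍ n^{-9/16}`, not summable; exact enumeration of the mixed kernel (`= Π − Corr`, same norm,
same source) gives `x_c^n‖K_n‖₁ = .345, .541, .487, .500, .439, .420, .375, .361, .324` (`n = 4..12`),
effective exponent `≈ 0.6 < 1` over `n = 6 → 12` (route header: `0.77` at `n = 14` in its matrix norm, rising).
If this stub is refuted the crux as typed falls with it while stub 2 (the card's statement) survives: the
repair is the first-step restatement `K := Π^σ` recommended in `conventions_evidence.md`. -/
theorem stub_conjugationSummable : ConjugationSummable := by
  sorry

/-! ### Name-keyed aliases of the stub statements (hypotheses of the composition)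

`Registered.stub_X : Prop` is the statement of `stub_X` under the registered stub's short name, so that the
skeleton audit (hypotheses admissible iff registered stubs BY NAME) accepts
`TwistedKernelSummable_of : Registered.stub_… → … → TwistedKernelSummable` (device of
`Cruxes/ChainLaw/Lines/birth.lean`, `Cruxes/ObservableLimitFlat/Lines/birth.lean`). -/
namespace Registered

/-- Alias keyed by the registered stub name. -/
abbrev stub_mixedKernelIdentification : Prop := MixedKernelIdentification
/-- Alias keyed by the registered stub name. -/
abbrev stub_laceKernelSummable : Prop := LaceKernelSummable
/-- Alias keyed by the registered stub name. -/
abbrev stub_conjugationSummable : Prop := ConjugationSummable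

end Registered

/-! ### 4. The composition (kernel-checked, no `sorry`) -/

/-- **The three stubs imply the crux `TwistedKernelSummable` BY NAME.** The crux's `let`-vocabulary
(`dir, σ, T, G, IsTwistedKernel`) unfolds definitionally to `stepDir, 5/8, mixedT, mixedG, IsMixedKernel`
(`show`). Given a mixed kernel `K`: for `n ≥ 1`, stub 1 gives `K_n(z) = Π_n(z) − Corr_n(z)`, so entrywise
`|K_n(z)| ≤ |Π_n(z)| + |Corr_n(z)|`; for `n = 0` the support clause gives `K_0(z) = 0` off the origin and
`K_0(0)` contributes one summand. Hence `x_c^n Σ|K_n(z)|` is dominated by the summable majorant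
`x_c^n Σ|Π_n(z)| + x_c^n Σ|Corr_n(z)| + 𝟙_{(n,z)=(0,0)} Σ|K_0(0)|` (stubs 2, 3, `hasSum_ite_eq`), and
`Summable.of_nonneg_of_le` concludes. -/
theorem TwistedKernelSummable_of (h₁ : Registered.stub_mixedKernelIdentification)
    (h₂ : Registered.stub_laceKernelSummable) (h₃ : Registered.stub_conjugationSummable) :
    Summit.CriticalPhenomena.SAWScalingLimit.Theses.SAWTwistedSelfEnergy.TwistedKernelSummable := by
  -- the crux, with its `let`s inlined, is literally the statement over the named vocabulary
  show ∀ K : ℕ → Site 2 → Matrix (Fin 4) (Fin 4) ℂ, IsMixedKernel K →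
    Summable (fun p : ℕ × Site 2 =>
      criticalFugacity ^ p.1 * ∑ ι : Fin 4, ∑ κ : Fin 4, ‖K p.1 p.2 ι κ‖)
  intro K hK
  have h₁' : ∀ K : ℕ → Site 2 → Matrix (Fin 4) (Fin 4) ℂ, IsMixedKernel K →
      ∀ n, 1 ≤ n → ∀ z, K n z = twistedLaceCoefficient (5 / 8) n z - mixedCorrection n z := h₁
  have h₂' : Summable (fun p : ℕ × Site 2 =>
      criticalFugacity ^ p.1 * ∑ ι : Fin 4, ∑ κ : Fin 4,
        ‖twistedLaceCoefficient (5 / 8) p.1 p.2 ι κ‖) := h₂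
  have h₃' : Summable (fun p : ℕ × Site 2 =>
      criticalFugacity ^ p.1 * ∑ ι : Fin 4, ∑ κ : Fin 4, ‖mixedCorrection p.1 p.2 ι κ‖) := h₃
  -- (0) `x_c = 1/μ(ℤ²) > 0`
  have hxc : 0 ≤ criticalFugacity := by
    have h := Literature.Probability.RandomPlanarGeometry.SAW.Zd.connectiveConstant_pos 2
    rw [Literature.Probability.RandomPlanarGeometry.SAW.Zd.connectiveConstant_two] at h
    unfold Literature.Probability.RandomPlanarGeometry.SAW.criticalFugacity
    exact (inv_pos.2 h).le
  -- (1) the identification from length 1 on, and the support clause at length 0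
  have hid : ∀ n, 1 ≤ n → ∀ z, K n z = twistedLaceCoefficient (5 / 8) n z - mixedCorrection n z :=
    h₁' K hK
  have h0 : ∀ z : Site 2, z ≠ 0 → K 0 z = 0 := by
    intro z hz
    refine hK.1 0 z fun hz' => hz ?_
    funext i
    have hi := (mem_box.1 hz') i
    simp only [Nat.cast_zero, neg_zero] at hi
    exact le_antisymm hi.2 hi.1
  -- (2) the summable majorant
  have hmaj : Summable (fun p : ℕ × Site 2 =>
      (criticalFugacity ^ p.1 * ∑ ι : Fin 4, ∑ κ : Fin 4,
          ‖twistedLaceCoefficient (5 / 8) p.1 p.2 ι κ‖ +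
        criticalFugacity ^ p.1 * ∑ ι : Fin 4, ∑ κ : Fin 4, ‖mixedCorrection p.1 p.2 ι κ‖) +
      (if p = ((0 : ℕ), (0 : Site 2)) then ∑ ι : Fin 4, ∑ κ : Fin 4, ‖K 0 0 ι κ‖ else 0)) :=
    (h₂'.add h₃').add (hasSum_ite_eq _ _).summable
  -- (3) comparison
  refine Summable.of_nonneg_of_le (fun p => ?_) (fun p => ?_) hmaj
  · exact mul_nonneg (pow_nonneg hxc _)
      (Finset.sum_nonneg fun ι _ => Finset.sum_nonneg fun κ _ => norm_nonneg _)
  · obtain ⟨n, z⟩ := p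
    dsimp only
    have hA : 0 ≤ criticalFugacity ^ n * ∑ ι : Fin 4, ∑ κ : Fin 4,
        ‖twistedLaceCoefficient (5 / 8) n z ι κ‖ :=
      mul_nonneg (pow_nonneg hxc _)
        (Finset.sum_nonneg fun ι _ => Finset.sum_nonneg fun κ _ => norm_nonneg _)
    have hB : 0 ≤ criticalFugacity ^ n * ∑ ι : Fin 4, ∑ κ : Fin 4, ‖mixedCorrection n z ι κ‖ :=
      mul_nonneg (pow_nonneg hxc _)
        (Finset.sum_nonneg fun ι _ => Finset.sum_nonneg fun κ _ => norm_nonneg _)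
    have hC : 0 ≤ (if (n, z) = ((0 : ℕ), (0 : Site 2)) then ∑ ι : Fin 4, ∑ κ : Fin 4, ‖K 0 0 ι κ‖
        else 0) := by
      split_ifs
      · exact Finset.sum_nonneg fun ι _ => Finset.sum_nonneg fun κ _ => norm_nonneg _
      · exact le_rfl
    rcases Nat.eq_zero_or_pos n with rfl | hn
    · -- length 0
      by_cases hz : z = 0
      · subst hz
        rw [if_pos rfl]
        have hone : criticalFugacity ^ 0 * ∑ ι : Fin 4, ∑ κ : Fin 4, ‖K 0 0 ι κ‖ =
            ∑ ι : Fin 4, ∑ κ : Fin 4, ‖K 0 0 ι κ‖ := by rw [pow_zero, one_mul]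
        rw [hone]
        exact le_add_of_nonneg_left (add_nonneg hA hB)
      · rw [h0 z hz]
        have hzero : criticalFugacity ^ 0 * ∑ ι : Fin 4, ∑ κ : Fin 4,
            ‖(0 : Matrix (Fin 4) (Fin 4) ℂ) ι κ‖ = 0 := by simp
        rw [hzero]
        exact add_nonneg (add_nonneg hA hB) hC
    · -- length ≥ 1: the identification and the triangle inequality, entrywise
      have hK' : ∀ ι κ : Fin 4, ‖K n z ι κ‖ ≤
          ‖twistedLaceCoefficient (5 / 8) n z ι κ‖ + ‖mixedCorrection n z ι κ‖ := fun ι κ => by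
        rw [hid n hn z, Matrix.sub_apply]
        exact norm_sub_le _ _
      calc criticalFugacity ^ n * ∑ ι : Fin 4, ∑ κ : Fin 4, ‖K n z ι κ‖
          ≤ criticalFugacity ^ n * ∑ ι : Fin 4, ∑ κ : Fin 4,
              (‖twistedLaceCoefficient (5 / 8) n z ι κ‖ + ‖mixedCorrection n z ι κ‖) :=
            mul_le_mul_of_nonneg_left
              (Finset.sum_le_sum fun ι _ => Finset.sum_le_sum fun κ _ => hK' ι κ) (pow_nonneg hxc _)
        _ = criticalFugacity ^ n * ∑ ι : Fin 4, ∑ κ : Fin 4, ‖twistedLaceCoefficient (5 / 8) n z ι κ‖ +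
              criticalFugacity ^ n * ∑ ι : Fin 4, ∑ κ : Fin 4, ‖mixedCorrection n z ι κ‖ := by
            simp only [Finset.sum_add_distrib, mul_add]
        _ ≤ _ := le_add_of_nonneg_right hC

/-- Wiring check: the registered stubs feed `TwistedKernelSummable_of` as stated. -/
example : Summit.CriticalPhenomena.SAWScalingLimit.Theses.SAWTwistedSelfEnergy.TwistedKernelSummable :=
  TwistedKernelSummable_of stub_mixedKernelIdentification stub_laceKernelSummable stub_conjugationSummable

end Summit.CriticalPhenomena.SAWScalingLimit.Cruxes.TwistedKernelSummable.Birth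

end
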